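import Summits.AtomisticToContinuum.Crystallization.Theses.GappedShellCensus

/-!
# Stub `stub_tfCircleThree` — planar pigeonhole for three vectors
# (crux `GappedShellCensus.TornFree`, line `Sketch`)

Three vectors `q 0, q 1, q 2` of `ℝ³` orthogonal to a fixed `b ≠ 0` leave a unit direction `e ⊥ b`
at angle `≥ 60°` from each of them, `⟪q i, e⟫ ≤ ‖q i‖ / 2`: three open arcs of length `120°` do
not cover the circle.

The proof is trigonometry-free.  An orthonormal frame `(u, v)` of the plane `bᗮ`
(`tfCircleThree_frame`) turns the statement into real arithmetic on planar coordinates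
`(x i, y i) = (⟪q i, u⟫, ⟪q i, v⟫)` with `‖q i‖² = x i² + y i²` (`tfCircleThree_real`).  Rotate so
that `q 0` points along `+x` (`tfCircleThree_std`).  The three unit directions at angles `60°`,
`180°`, `300°` — `(1/2, √3/2)`, `(-1, 0)`, `(1/2, -√3/2)` — are each at angle `≥ 60°` from `q 0`,
and any two of them sum to minus the third, a unit vector; so by the planar Cauchy–Schwarz
inequality (`tfCircleThree_cs`) a single vector is at angle `< 60°` from at most one of them
(`tfCircleThree_pair`).  Hence `q 1` and `q 2` exclude at most two of the three directions.
-/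

noncomputable section

namespace Summit.AtomisticToContinuum.Crystallization.Theorems

open scoped RealInnerProductSpace

/-- Planar Cauchy–Schwarz: a unit vector `(α, β)` has inner product `≤ r` with a vector `(x, y)`
of length `r`. -/
private theorem tfCircleThree_cs {α β x y r : ℝ} (h : α ^ 2 + β ^ 2 = 1) (hr : 0 ≤ r)
    (hrr : r ^ 2 = x ^ 2 + y ^ 2) : α * x + β * y ≤ r := by
  refine not_lt.mp fun hcon => ?_
  have e : (α * x + β * y) ^ 2 + (α * y - β * x) ^ 2 = (α ^ 2 + β ^ 2) * r ^ 2 := by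
    rw [hrr]; ring
  rw [h, one_mul] at e
  nlinarith [sq_nonneg (α * y - β * x), mul_self_lt_mul_self hr hcon]

/-- Two unit directions whose sum is again a unit vector are never both at angle `< 60°` from
the same planar vector. -/
private theorem tfCircleThree_pair {α β α' β' x y r : ℝ}
    (h : (α + α') ^ 2 + (β + β') ^ 2 = 1) (hr : 0 ≤ r) (hrr : r ^ 2 = x ^ 2 + y ^ 2)
    (h1 : 1 / 2 * r < α * x + β * y) : α' * x + β' * y ≤ 1 / 2 * r := by
  have h2 := tfCircleThree_cs h hr hrr
  linarith

/-- Standard position (`q 0` along `+x`): one of the unit directions at `60°`, `180°`, `300°` is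
at angle `≥ 60°` from all three planar vectors `(x i, y i)` of lengths `r i`. -/
private theorem tfCircleThree_std (x y r : Fin 3 → ℝ) (hr : ∀ i, 0 ≤ r i)
    (hrr : ∀ i, r i ^ 2 = x i ^ 2 + y i ^ 2) (hx0 : x 0 = r 0) (hy0 : y 0 = 0) :
    ∃ α β : ℝ, α ^ 2 + β ^ 2 = 1 ∧ ∀ i, α * x i + β * y i ≤ 1 / 2 * r i := by
  obtain ⟨t, ht⟩ : ∃ t : ℝ, t ^ 2 = 3 := ⟨Real.sqrt 3, Real.sq_sqrt (by norm_num)⟩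
  -- the candidates `(1/2, t/2)`, `(-1, 0)`, `(1/2, -(t/2))` and their pairwise sums are unit
  have u1 : (1 / 2 : ℝ) ^ 2 + (t / 2) ^ 2 = 1 := by linear_combination ht / 4
  have u2 : (-1 : ℝ) ^ 2 + (0 : ℝ) ^ 2 = 1 := by norm_num
  have u3 : (1 / 2 : ℝ) ^ 2 + (-(t / 2)) ^ 2 = 1 := by linear_combination ht / 4
  have s12 : (1 / 2 + -1 : ℝ) ^ 2 + (t / 2 + 0) ^ 2 = 1 := by linear_combination ht / 4
  have s13 : (1 / 2 + 1 / 2 : ℝ) ^ 2 + (t / 2 + -(t / 2)) ^ 2 = 1 := by ring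
  have s23 : (-1 + 1 / 2 : ℝ) ^ 2 + (0 + -(t / 2)) ^ 2 = 1 := by linear_combination ht / 4
  -- three pointwise bounds give the bound for all `i : Fin 3`
  have key : ∀ {a c : ℝ}, a * x 0 + c * y 0 ≤ 1 / 2 * r 0 → a * x 1 + c * y 1 ≤ 1 / 2 * r 1 →
      a * x 2 + c * y 2 ≤ 1 / 2 * r 2 → ∀ i, a * x i + c * y i ≤ 1 / 2 * r i := by
    intro a c h0 h1 h2 i
    fin_cases i <;> assumption
  -- `q 0` is at angle `≥ 60°` from all three candidates
  have h01 : 1 / 2 * x 0 + t / 2 * y 0 ≤ 1 / 2 * r 0 := by rw [hx0, hy0]; linarith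
  have h02 : -1 * x 0 + 0 * y 0 ≤ 1 / 2 * r 0 := by rw [hx0, hy0]; linarith [hr 0]
  have h03 : 1 / 2 * x 0 + -(t / 2) * y 0 ≤ 1 / 2 * r 0 := by rw [hx0, hy0]; linarith
  rcases le_or_gt (1 / 2 * x 1 + t / 2 * y 1) (1 / 2 * r 1) with h11 | h11
  · rcases le_or_gt (1 / 2 * x 2 + t / 2 * y 2) (1 / 2 * r 2) with h12 | h12
    · exact ⟨1 / 2, t / 2, u1, key h01 h11 h12⟩
    · -- candidate 1 fails at `q 2`, so candidates 2 and 3 are fine there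
      have h22 := tfCircleThree_pair s12 (hr 2) (hrr 2) h12
      have h32 := tfCircleThree_pair s13 (hr 2) (hrr 2) h12
      rcases le_or_gt (-1 * x 1 + 0 * y 1) (1 / 2 * r 1) with h21 | h21
      · exact ⟨-1, 0, u2, key h02 h21 h22⟩
      · have h31 := tfCircleThree_pair s23 (hr 1) (hrr 1) h21
        exact ⟨1 / 2, -(t / 2), u3, key h03 h31 h32⟩
  · -- candidate 1 fails at `q 1`, so candidates 2 and 3 are fine there
    have h21 := tfCircleThree_pair s12 (hr 1) (hrr 1) h11
    have h31 := tfCircleThree_pair s13 (hr 1) (hrr 1) h11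
    rcases le_or_gt (-1 * x 2 + 0 * y 2) (1 / 2 * r 2) with h22 | h22
    · exact ⟨-1, 0, u2, key h02 h21 h22⟩
    · have h32 := tfCircleThree_pair s23 (hr 2) (hrr 2) h22
      exact ⟨1 / 2, -(t / 2), u3, key h03 h31 h32⟩

/-- Planar pigeonhole in coordinates: for three planar vectors `(x i, y i)` of lengths `r i` there
is a unit direction `(α, β)` at angle `≥ 60°` from each of them.  Reduction to the standard
position by the rotation taking `(x 0, y 0)` to `(r 0, 0)`. -/
private theorem tfCircleThree_real (x y r : Fin 3 → ℝ) (hr : ∀ i, 0 ≤ r i)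
    (hrr : ∀ i, r i ^ 2 = x i ^ 2 + y i ^ 2) :
    ∃ α β : ℝ, α ^ 2 + β ^ 2 = 1 ∧ ∀ i, α * x i + β * y i ≤ 1 / 2 * r i := by
  rcases (hr 0).eq_or_lt with h0 | h0
  · -- `q 0 = 0`: already in standard position
    have hxy : x 0 ^ 2 + y 0 ^ 2 = 0 := by rw [← hrr 0, ← h0]; norm_num
    have hx0 : x 0 = 0 := sq_eq_zero_iff.mp (by linarith [sq_nonneg (x 0), sq_nonneg (y 0)])
    have hy0 : y 0 = 0 := sq_eq_zero_iff.mp (by linarith [sq_nonneg (x 0), sq_nonneg (y 0)])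
    exact tfCircleThree_std x y r hr hrr (by rw [hx0]; exact h0) hy0
  · -- rotate `(x 0, y 0)` to `(r 0, 0)`
    have hr0 : r 0 ≠ 0 := h0.ne'
    have hrr' : ∀ i, r i ^ 2 =
        ((x 0 * x i + y 0 * y i) / r 0) ^ 2 + ((x 0 * y i - y 0 * x i) / r 0) ^ 2 := by
      intro i
      rw [div_pow, div_pow, ← add_div, eq_div_iff (pow_ne_zero 2 hr0)]
      linear_combination r 0 ^ 2 * hrr i + (x i ^ 2 + y i ^ 2) * hrr 0
    have hx0 : (x 0 * x 0 + y 0 * y 0) / r 0 = r 0 := by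
      rw [div_eq_iff hr0]; linear_combination -hrr 0
    have hy0 : (x 0 * y 0 - y 0 * x 0) / r 0 = 0 := by rw [mul_comm, sub_self, zero_div]
    obtain ⟨α, β, hab, h⟩ := tfCircleThree_std (fun i => (x 0 * x i + y 0 * y i) / r 0)
      (fun i => (x 0 * y i - y 0 * x i) / r 0) r hr hrr' hx0 hy0
    refine ⟨(α * x 0 - β * y 0) / r 0, (α * y 0 + β * x 0) / r 0, ?_, fun i => ?_⟩
    · rw [div_pow, div_pow, ← add_div, div_eq_one_iff_eq (pow_ne_zero 2 hr0)]
      linear_combination (x 0 ^ 2 + y 0 ^ 2) * hab - hrr 0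
    · have hi : α * ((x 0 * x i + y 0 * y i) / r 0) + β * ((x 0 * y i - y 0 * x i) / r 0) ≤
          1 / 2 * r i := h i
      have e : (α * x 0 - β * y 0) / r 0 * x i + (α * y 0 + β * x 0) / r 0 * y i =
          α * ((x 0 * x i + y 0 * y i) / r 0) + β * ((x 0 * y i - y 0 * x i) / r 0) := by
        field_simp
        ring
      rw [e]
      exact hi

-- adapted from `ffrCircle_frame` (Theorems/GappedShellCensusFiveFoldRationingRStubFfrCircle.lean)
/-- An orthonormal frame `(u, v)` of the plane `bᗮ ⊆ ℝ³` (`b ≠ 0`), with Parseval's identity for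
vectors orthogonal to `b`. -/
private theorem tfCircleThree_frame (b : EuclideanSpace ℝ (Fin 3)) (hb : b ≠ 0) :
    ∃ u v : EuclideanSpace ℝ (Fin 3), ‖u‖ = 1 ∧ ‖v‖ = 1 ∧ ⟪u, v⟫ = 0 ∧ ⟪u, b⟫ = 0 ∧
      ⟪v, b⟫ = 0 ∧ ∀ q : EuclideanSpace ℝ (Fin 3), ⟪q, b⟫ = 0 →
        ‖q‖ ^ 2 = ⟪q, u⟫ ^ 2 + ⟪q, v⟫ ^ 2 := by
  haveI : Fact (Module.finrank ℝ (EuclideanSpace ℝ (Fin 3)) = 2 + 1) := ⟨by simp⟩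
  have hK : Module.finrank ℝ (ℝ ∙ b)ᗮ = 2 := Submodule.finrank_orthogonal_span_singleton hb
  let ob : OrthonormalBasis (Fin 2) ℝ (ℝ ∙ b)ᗮ :=
    (stdOrthonormalBasis ℝ (ℝ ∙ b)ᗮ).reindex (finCongr hK)
  refine ⟨(ob 0 : EuclideanSpace ℝ (Fin 3)), (ob 1 : EuclideanSpace ℝ (Fin 3)), ?_, ?_, ?_, ?_,
    ?_, fun q hq => ?_⟩
  · rw [Submodule.norm_coe]; exact ob.norm_eq_one 0
  · rw [Submodule.norm_coe]; exact ob.norm_eq_one 1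
  · rw [← Submodule.coe_inner]; exact ob.inner_eq_zero (by decide)
  · exact Submodule.mem_orthogonal_singleton_iff_inner_left.mp (ob 0).2
  · exact Submodule.mem_orthogonal_singleton_iff_inner_left.mp (ob 1).2
  · have hqK : q ∈ (ℝ ∙ b)ᗮ := Submodule.mem_orthogonal_singleton_iff_inner_left.mpr hq
    have h := ob.sum_inner_mul_inner ⟨q, hqK⟩ ⟨q, hqK⟩
    rw [Fin.sum_univ_two] at h
    simp only [Submodule.coe_inner] at h
    rw [← real_inner_self_eq_norm_sq, ← h, real_inner_comm q, real_inner_comm q]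
    ring

/-- **Stub 2 (planar pigeonhole for three vectors).** Three vectors orthogonal to `b ≠ 0` leave a
unit direction `e ⊥ b` making an angle `≥ 60°` with each of them (`⟪q i, e⟫ ≤ ‖q i‖ / 2`): three
open arcs of length `120°` do not cover the circle. [folklore] -/
theorem stub_tfCircleThree :
    ∀ b : EuclideanSpace ℝ (Fin 3), b ≠ 0 → ∀ q : Fin 3 → EuclideanSpace ℝ (Fin 3),
      (∀ i, ⟪q i, b⟫ = 0) →
      ∃ e : EuclideanSpace ℝ (Fin 3), ‖e‖ = 1 ∧ ⟪e, b⟫ = 0 ∧ ∀ i, ⟪q i, e⟫ ≤ 1 / 2 * ‖q i‖ := by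
  intro b hb q hqb
  obtain ⟨u, v, hu, hv, huv, hub, hvb, hP⟩ := tfCircleThree_frame b hb
  obtain ⟨α, β, hab, h⟩ := tfCircleThree_real (fun i => ⟪q i, u⟫) (fun i => ⟪q i, v⟫)
    (fun i => ‖q i‖) (fun i => norm_nonneg _) (fun i => hP (q i) (hqb i))
  have hvu : ⟪v, u⟫ = 0 := by rw [real_inner_comm]; exact huv
  refine ⟨α • u + β • v, ?_, ?_, fun i => ?_⟩
  · have hn : ⟪α • u + β • v, α • u + β • v⟫ = α ^ 2 + β ^ 2 := by
      simp only [inner_add_left, inner_add_right, real_inner_smul_left, real_inner_smul_right]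
      rw [real_inner_self_eq_norm_sq, real_inner_self_eq_norm_sq, hu, hv, huv, hvu]
      ring
    rw [norm_eq_sqrt_real_inner, hn, hab, Real.sqrt_one]
  · rw [inner_add_left, real_inner_smul_left, real_inner_smul_left, hub, hvb, mul_zero, mul_zero,
      add_zero]
  · have hi : α * ⟪q i, u⟫ + β * ⟪q i, v⟫ ≤ 1 / 2 * ‖q i‖ := h i
    rw [inner_add_right, real_inner_smul_right, real_inner_smul_right]
    exact hi

end Summit.AtomisticToContinuum.Crystallization.Theorems

end
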